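import Mathlib
import Summits.NavierStokesRegularity.NavierStokesRegularity.Theses.FilamentSkeletonRss
import Literature.Analysis.FluidPDE.PineauVicolRDSSLeray
import Summits.NavierStokesRegularity.NavierStokesRegularity.Theorems.FilamentSkeletonRssCoreGluingProfileSuffices
import Summits.NavierStokesRegularity.NavierStokesRegularity.Theorems.FilamentSkeletonRssCoreGluingPoincareMiranda

/-!
# Route `FilamentSkeletonRss` · crux `CoreGluing` (stmt-NavierStokesRegularity-15401) — the quantitative split glue, landed

The crux-strategist s1 (2026-08-17T08:2x–08:38Z) prepared and certified the decomposition of `CoreGluing` into two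
QUANTITATIVE children (`Cruxes/CoreGluing/SPLIT-s1.md`; statements = the registered reshape-2 stubs of line
`zero-accretion-selection`, sha ab900422, with `rotGen ↦ cross e₃`, `Δ ↦ Laplacian.laplacian`):

* `SelectionBox` — an `N`-parameter box of ball-exact quantitative filament skeletons + the accretion sign law;
* `TransverseReduction` — every such box carries a continuous reduced profile family modulo the `N` accretion modes;

with the kernel-checked glue `SelectionBox → TransverseReduction → RssProfileExists / CoreGluing` kept as the workfile
`Cruxes/CoreGluing/CoreGluingSplitGlue.lean` (a strategist cannot write under `Theorems/`).  Lead c12 lands that glue here verbatim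
(proof = lead c4's `CoreGluing_of`: box → reduced family → opposite face signs → Poincaré–Miranda zero `p⋆`
(`Theorems.stub_poincareMiranda`, p139006) → exact profile `U_{p⋆}` → `RssProfileExists` (`Theorems.stub_rssProfileExists_of_profile`,
p130189)), under tree-unique names, so that planners can `route edit --split … --glue-by` / `--restate` a TREE theorem and so that the
rev-6 restatement of stmt-17944 (`CoreLinearInvertibility → TransverseReduction`, `Cruxes/CoreGluing/Restatement_c12.lean`) composes
over `Theorems` imports only.  Registered tools stub: `stub_coreGluingSplit` (type `SelectionBox → TransverseReduction → CoreGluing`,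
statements inlined).  The hypothesis `SkeletonEquilibrium` of the crux is never consumed.
-/

set_option linter.dupNamespace false

noncomputable section

namespace Summit.NavierStokesRegularity.NavierStokesRegularity.Theorems

open Set Function Filter MeasureTheory Real
open Literature.Analysis.FluidPDE Literature.Analysis.FluidPDE.PineauVicol2026
open scoped RealInnerProductSpace Laplacian ContDiff Topology

/-- The infinitesimal rotation about `e₃` is the cross product with `e₃`: `J v = e₃ × v`. [folklore] -/
theorem splitGlue_rotGen_eq_cross_single_two (v : EuclideanSpace ℝ (Fin 3)) :
    rotGen v = cross (EuclideanSpace.single (2 : Fin 3) (1 : ℝ)) v := by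
  ext i
  fin_cases i <;> simp [rotGen, cross, cross_apply]

/-- **The two children give the route TARGET** (crux-strategist decomposition, 2026-08-17):
`SelectionBox → TransverseReduction → RssProfileExists` — the `SkeletonEquilibrium`-free content of the split
(this is the statement a tenure re-glue `closes : SelectionBox → TransverseReduction → RdssProfileTruncation → ¬NS`
consumes).  The two hypotheses are the children's statements verbatim. -/
theorem rssProfileExists_of_selectionBox_transverseReduction :
    (∃ (N : ℕ) (δ ρ K Λ a b cnd η Rw Rb cg Γ₂ : ℝ), 0 < N ∧ 0 < δ ∧ 0 < ρ ∧ 0 < cnd ∧ 0 < η ∧ 0 < Rw ∧ 0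
    < Rb ∧ 0 < cg ∧ ∀ Γ : ℝ, Γ₂ ≤ Γ → ∃ (γ : (Fin N → ℝ) → Fin N → ℝ) (α : (Fin N → ℝ) → ℝ) (X : (Fin N
    → ℝ) → Fin N → ℝ → EuclideanSpace ℝ (Fin 3)) (w : (Fin N → ℝ) → Fin N → ℝ → ℝ) (c : (Fin N → ℝ) →
    Fin N → ℝ) (m n : (Fin N → ℝ) → Fin N → EuclideanSpace ℝ (Fin 3)), ∀ (u : (Fin N → ℝ) → (Fin N → ℝ →
    EuclideanSpace ℝ (Fin 3)) → EuclideanSpace ℝ (Fin 3) → EuclideanSpace ℝ (Fin 3)) (v : (Fin N → ℝ) →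
    EuclideanSpace ℝ (Fin 3) → EuclideanSpace ℝ (Fin 3)) (A : (Fin N → ℝ) → Fin N → (EuclideanSpace ℝ
    (Fin 3) →L[ℝ] EuclideanSpace ℝ (Fin 3))) (T : (Fin N → ℝ) → (Fin N → ℝ → EuclideanSpace ℝ (Fin 3)) →
    Fin N → ℝ → EuclideanSpace ℝ (Fin 3)) (D : (Fin N → ℝ) → Fin N → EuclideanSpace ℝ (Fin 3) →
    EuclideanSpace ℝ (Fin 3)), (∀ p Z y, u p Z y = ∑ k : Fin N, (Γ * γ p k / (4 * Real.pi)) • ∫ σ : ℝ,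
    ((‖y - Z k σ‖ ^ 2 + 1) ^ (3 / 2 : ℝ))⁻¹ • Literature.Analysis.FluidPDE.cross (deriv (Z k) σ) (y - Z
    k σ)) → (∀ p y, v p y = u p (X p) y + (1 / 2 : ℝ) • y - α p • Literature.Analysis.FluidPDE.cross
    (EuclideanSpace.single (2 : Fin 3) (1 : ℝ)) y) → (∀ p j, A p j = fderiv ℝ (v p) (X p j (c p j))) →
    (∀ p Z j τ, T p Z j τ = (u p Z (Z j τ) + (1 / 2 : ℝ) • Z j τ - α p •
    Literature.Analysis.FluidPDE.cross (EuclideanSpace.single (2 : Fin 3) (1 : ℝ)) (Z j τ)) - (inner ℝ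
    (u p Z (Z j τ) + (1 / 2 : ℝ) • Z j τ - α p • Literature.Analysis.FluidPDE.cross
    (EuclideanSpace.single (2 : Fin 3) (1 : ℝ)) (Z j τ)) (deriv (Z j) τ) / ‖deriv (Z j) τ‖ ^ 2) • deriv
    (Z j) τ) → (∀ p j y, D p j y = (Real.exp (-(inner ℝ (y - X p j (c p j)) (deriv (X p j) (c p j))) ^
    2) * ((1 - Real.exp (-(‖y - X p j (c p j)‖ ^ 2 - inner ℝ (y - X p j (c p j)) (deriv (X p j) (c p j))
    ^ 2))) / (‖y - X p j (c p j)‖ ^ 2 - inner ℝ (y - X p j (c p j)) (deriv (X p j) (c p j)) ^ 2))) •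
    Literature.Analysis.FluidPDE.cross (deriv (X p j) (c p j)) (y - X p j (c p j))) → ((∀ j,
    ContinuousOn (fun q : (Fin N → ℝ) × ℝ => (α q.1, γ q.1 j, X q.1 j q.2, w q.1 j q.2)) ({p : Fin N → ℝ
    | ∀ i, p i ∈ Set.Icc (0:ℝ) 1} ×ˢ Set.univ)) ∧ (∀ p : Fin N → ℝ, (∀ i, p i ∈ Set.Icc (0:ℝ) 1) → α p ≠
    0 ∧ (∀ j, γ p j ≠ 0) ∧ (∀ j, ContDiff ℝ 2 (X p j) ∧ Differentiable ℝ (w p j) ∧ (∀ τ, ‖deriv (X p j)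
    τ‖ = 1) ∧ (∀ τ, ‖iteratedDeriv 2 (X p j) τ‖ * Real.sqrt Γ ≤ K) ∧ Filter.Tendsto (fun τ => ‖X p j τ‖)
    (Filter.cocompact ℝ) Filter.atTop) ∧ (∀ j k, j ≠ k → ∀ τ σ, ρ * Real.sqrt Γ ≤ ‖X p j τ - X p k σ‖) ∧
    (∀ j τ σ, ρ * Real.sqrt Γ ≤ |τ - σ| → cg * ρ * Real.sqrt Γ ≤ ‖X p j τ - X p j σ‖) ∧ (∀ j τ, cg * |τ
    - c p j| ≤ Rw * Real.sqrt Γ + ‖X p j τ‖) ∧ (∀ j τ, w p j τ = inner ℝ (v p (X p j τ)) (deriv (X p j)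
    τ)) ∧ (∀ j τ, ‖X p j τ‖ ≤ Rb * Real.sqrt (Γ * Real.log Γ) → v p (X p j τ) = w p j τ • deriv (X p j)
    τ) ∧ (∀ j, ‖X p j (c p j)‖ ≤ Rw * Real.sqrt Γ) ∧ (∀ j, w p j (c p j) = 0 ∧ (∀ τ, w p j τ = 0 → τ = c
    p j) ∧ 3 / 2 + δ ≤ deriv (w p j) (c p j) ∧ deriv (w p j) (c p j) ≤ Λ) ∧ (∀ j, Orthonormal ℝ ![deriv
    (X p j) (c p j), m p j, n p j] ∧ inner ℝ (A p j (m p j)) (m p j) + inner ℝ (A p j (n p j)) (n p j) <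
    0 ∧ inner ℝ (A p j (n p j)) (m p j) * inner ℝ (A p j (m p j)) (n p j) < inner ℝ (A p j (m p j)) (m p
    j) * inner ℝ (A p j (n p j)) (n p j)) ∧ (∀ Y : Fin N → ℝ → EuclideanSpace ℝ (Fin 3), (∀ j, ContDiff
    ℝ 2 (Y j)) → (∀ j τ, inner ℝ (Y j τ) (deriv (X p j) τ) = 0) → ∑ j : Fin N, inner ℝ (Y j (c p j))
    (Literature.Analysis.FluidPDE.cross (EuclideanSpace.single (2 : Fin 3) (1 : ℝ)) (X p j (c p j))) = 0
    → (∀ j τ, ‖Y j τ‖ + ‖deriv (Y j) τ‖ + ‖iteratedDeriv 2 (Y j) τ‖ ≤ (1 + |τ - c p j|) ^ b) → ∀ L : ℝ,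
    (∀ j τ, ‖deriv (fun s : ℝ => T p (fun k σ => X p k σ + s • Y k σ) j τ) 0‖ ≤ L * (1 + |τ - c p j|) ^
    a) → ∀ j τ, ‖Y j τ‖ ≤ cnd * L * (1 + |τ - c p j|) ^ b))) ∧ (∀ (C₀ M : ℝ) (U : (Fin N → ℝ) →
    EuclideanSpace ℝ (Fin 3) → EuclideanSpace ℝ (Fin 3)) (P : (Fin N → ℝ) → EuclideanSpace ℝ (Fin 3) →
    ℝ) (B : (Fin N → ℝ) → Fin N → ℝ), (ContinuousOn B {p : Fin N → ℝ | ∀ i, p i ∈ Set.Icc (0:ℝ) 1} ∧ ∀ p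
    : Fin N → ℝ, (∀ i, p i ∈ Set.Icc (0:ℝ) 1) → U p ≠ 0 ∧ ContDiff ℝ (⊤ : ℕ∞) (U p) ∧ ContDiff ℝ (⊤ :
    ℕ∞) (P p) ∧ Literature.Analysis.FluidPDE.VectorCalculus.IsDivFree (U p) ∧ (∀ y, α p •
    (Literature.Analysis.FluidPDE.cross (EuclideanSpace.single (2 : Fin 3) (1 : ℝ)) (U p y) - fderiv ℝ
    (U p) y (Literature.Analysis.FluidPDE.cross (EuclideanSpace.single (2 : Fin 3) (1 : ℝ)) y)) + (1 / 2
    : ℝ) • U p y + (1 / 2 : ℝ) • fderiv ℝ (U p) y y - (Laplacian.laplacian (U p)) y + fderiv ℝ (U p) y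
    (U p y) + gradient (P p) y = ∑ j : Fin N, B p j • D p j y) ∧ (∀ y, ‖U p y‖ ≤ C₀ / (1 + ‖y‖)) ∧ (∀ y,
    |P p y| ≤ M) ∧ (∀ y, ‖y‖ ≤ Rw * Real.sqrt Γ → (∀ j τ, ρ * Real.sqrt Γ / 4 ≤ ‖y - X p j τ‖) → ‖U p y
    - u p (X p) y‖ ≤ η * Real.sqrt Γ)) → (∀ (j : Fin N) (p q : Fin N → ℝ), (∀ i, p i ∈ Set.Icc (0:ℝ) 1)
    → (∀ i, q i ∈ Set.Icc (0:ℝ) 1) → p j = 0 → q j = 1 → B p j * B q j < 0))) →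
    (∀ (N : ℕ) (δ ρ K Λ a b cnd η Rw Rb cg : ℝ), 0 < N → 0 < δ → 0 < ρ → 0 < η → 0 < Rw → 0 < Rb → 0 < cg
    → ∃ Γ₁ : ℝ, ∀ Γ : ℝ, Γ₁ ≤ Γ → ∀ (γ : (Fin N → ℝ) → Fin N → ℝ) (α : (Fin N → ℝ) → ℝ) (X : (Fin N → ℝ)
    → Fin N → ℝ → EuclideanSpace ℝ (Fin 3)) (w : (Fin N → ℝ) → Fin N → ℝ → ℝ) (c : (Fin N → ℝ) → Fin N →
    ℝ) (m n : (Fin N → ℝ) → Fin N → EuclideanSpace ℝ (Fin 3)) (u : (Fin N → ℝ) → (Fin N → ℝ →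
    EuclideanSpace ℝ (Fin 3)) → EuclideanSpace ℝ (Fin 3) → EuclideanSpace ℝ (Fin 3)) (v : (Fin N → ℝ) →
    EuclideanSpace ℝ (Fin 3) → EuclideanSpace ℝ (Fin 3)) (A : (Fin N → ℝ) → Fin N → (EuclideanSpace ℝ
    (Fin 3) →L[ℝ] EuclideanSpace ℝ (Fin 3))) (T : (Fin N → ℝ) → (Fin N → ℝ → EuclideanSpace ℝ (Fin 3)) →
    Fin N → ℝ → EuclideanSpace ℝ (Fin 3)) (D : (Fin N → ℝ) → Fin N → EuclideanSpace ℝ (Fin 3) →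
    EuclideanSpace ℝ (Fin 3)), (∀ p Z y, u p Z y = ∑ k : Fin N, (Γ * γ p k / (4 * Real.pi)) • ∫ σ : ℝ,
    ((‖y - Z k σ‖ ^ 2 + 1) ^ (3 / 2 : ℝ))⁻¹ • Literature.Analysis.FluidPDE.cross (deriv (Z k) σ) (y - Z
    k σ)) → (∀ p y, v p y = u p (X p) y + (1 / 2 : ℝ) • y - α p • Literature.Analysis.FluidPDE.cross
    (EuclideanSpace.single (2 : Fin 3) (1 : ℝ)) y) → (∀ p j, A p j = fderiv ℝ (v p) (X p j (c p j))) →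
    (∀ p Z j τ, T p Z j τ = (u p Z (Z j τ) + (1 / 2 : ℝ) • Z j τ - α p •
    Literature.Analysis.FluidPDE.cross (EuclideanSpace.single (2 : Fin 3) (1 : ℝ)) (Z j τ)) - (inner ℝ
    (u p Z (Z j τ) + (1 / 2 : ℝ) • Z j τ - α p • Literature.Analysis.FluidPDE.cross
    (EuclideanSpace.single (2 : Fin 3) (1 : ℝ)) (Z j τ)) (deriv (Z j) τ) / ‖deriv (Z j) τ‖ ^ 2) • deriv
    (Z j) τ) → (∀ p j y, D p j y = (Real.exp (-(inner ℝ (y - X p j (c p j)) (deriv (X p j) (c p j))) ^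
    2) * ((1 - Real.exp (-(‖y - X p j (c p j)‖ ^ 2 - inner ℝ (y - X p j (c p j)) (deriv (X p j) (c p j))
    ^ 2))) / (‖y - X p j (c p j)‖ ^ 2 - inner ℝ (y - X p j (c p j)) (deriv (X p j) (c p j)) ^ 2))) •
    Literature.Analysis.FluidPDE.cross (deriv (X p j) (c p j)) (y - X p j (c p j))) → ((∀ j,
    ContinuousOn (fun q : (Fin N → ℝ) × ℝ => (α q.1, γ q.1 j, X q.1 j q.2, w q.1 j q.2)) ({p : Fin N → ℝ
    | ∀ i, p i ∈ Set.Icc (0:ℝ) 1} ×ˢ Set.univ)) ∧ (∀ p : Fin N → ℝ, (∀ i, p i ∈ Set.Icc (0:ℝ) 1) → α p ≠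
    0 ∧ (∀ j, γ p j ≠ 0) ∧ (∀ j, ContDiff ℝ 2 (X p j) ∧ Differentiable ℝ (w p j) ∧ (∀ τ, ‖deriv (X p j)
    τ‖ = 1) ∧ (∀ τ, ‖iteratedDeriv 2 (X p j) τ‖ * Real.sqrt Γ ≤ K) ∧ Filter.Tendsto (fun τ => ‖X p j τ‖)
    (Filter.cocompact ℝ) Filter.atTop) ∧ (∀ j k, j ≠ k → ∀ τ σ, ρ * Real.sqrt Γ ≤ ‖X p j τ - X p k σ‖) ∧
    (∀ j τ σ, ρ * Real.sqrt Γ ≤ |τ - σ| → cg * ρ * Real.sqrt Γ ≤ ‖X p j τ - X p j σ‖) ∧ (∀ j τ, cg * |τ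
    - c p j| ≤ Rw * Real.sqrt Γ + ‖X p j τ‖) ∧ (∀ j τ, w p j τ = inner ℝ (v p (X p j τ)) (deriv (X p j)
    τ)) ∧ (∀ j τ, ‖X p j τ‖ ≤ Rb * Real.sqrt (Γ * Real.log Γ) → v p (X p j τ) = w p j τ • deriv (X p j)
    τ) ∧ (∀ j, ‖X p j (c p j)‖ ≤ Rw * Real.sqrt Γ) ∧ (∀ j, w p j (c p j) = 0 ∧ (∀ τ, w p j τ = 0 → τ = c
    p j) ∧ 3 / 2 + δ ≤ deriv (w p j) (c p j) ∧ deriv (w p j) (c p j) ≤ Λ) ∧ (∀ j, Orthonormal ℝ ![deriv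
    (X p j) (c p j), m p j, n p j] ∧ inner ℝ (A p j (m p j)) (m p j) + inner ℝ (A p j (n p j)) (n p j) <
    0 ∧ inner ℝ (A p j (n p j)) (m p j) * inner ℝ (A p j (m p j)) (n p j) < inner ℝ (A p j (m p j)) (m p
    j) * inner ℝ (A p j (n p j)) (n p j)) ∧ (∀ Y : Fin N → ℝ → EuclideanSpace ℝ (Fin 3), (∀ j, ContDiff
    ℝ 2 (Y j)) → (∀ j τ, inner ℝ (Y j τ) (deriv (X p j) τ) = 0) → ∑ j : Fin N, inner ℝ (Y j (c p j))
    (Literature.Analysis.FluidPDE.cross (EuclideanSpace.single (2 : Fin 3) (1 : ℝ)) (X p j (c p j))) = 0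
    → (∀ j τ, ‖Y j τ‖ + ‖deriv (Y j) τ‖ + ‖iteratedDeriv 2 (Y j) τ‖ ≤ (1 + |τ - c p j|) ^ b) → ∀ L : ℝ,
    (∀ j τ, ‖deriv (fun s : ℝ => T p (fun k σ => X p k σ + s • Y k σ) j τ) 0‖ ≤ L * (1 + |τ - c p j|) ^
    a) → ∀ j τ, ‖Y j τ‖ ≤ cnd * L * (1 + |τ - c p j|) ^ b))) → ∃ (C₀ M : ℝ) (U : (Fin N → ℝ) →
    EuclideanSpace ℝ (Fin 3) → EuclideanSpace ℝ (Fin 3)) (P : (Fin N → ℝ) → EuclideanSpace ℝ (Fin 3) →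
    ℝ) (B : (Fin N → ℝ) → Fin N → ℝ), (ContinuousOn B {p : Fin N → ℝ | ∀ i, p i ∈ Set.Icc (0:ℝ) 1} ∧ ∀ p
    : Fin N → ℝ, (∀ i, p i ∈ Set.Icc (0:ℝ) 1) → U p ≠ 0 ∧ ContDiff ℝ (⊤ : ℕ∞) (U p) ∧ ContDiff ℝ (⊤ :
    ℕ∞) (P p) ∧ Literature.Analysis.FluidPDE.VectorCalculus.IsDivFree (U p) ∧ (∀ y, α p •
    (Literature.Analysis.FluidPDE.cross (EuclideanSpace.single (2 : Fin 3) (1 : ℝ)) (U p y) - fderiv ℝ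
    (U p) y (Literature.Analysis.FluidPDE.cross (EuclideanSpace.single (2 : Fin 3) (1 : ℝ)) y)) + (1 / 2
    : ℝ) • U p y + (1 / 2 : ℝ) • fderiv ℝ (U p) y y - (Laplacian.laplacian (U p)) y + fderiv ℝ (U p) y
    (U p y) + gradient (P p) y = ∑ j : Fin N, B p j • D p j y) ∧ (∀ y, ‖U p y‖ ≤ C₀ / (1 + ‖y‖)) ∧ (∀ y,
    |P p y| ≤ M) ∧ (∀ y, ‖y‖ ≤ Rw * Real.sqrt Γ → (∀ j τ, ρ * Real.sqrt Γ / 4 ≤ ‖y - X p j τ‖) → ‖U p y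
    - u p (X p) y‖ ≤ η * Real.sqrt Γ))) →
    Summit.NavierStokesRegularity.NavierStokesRegularity.Theses.FilamentSkeletonRss.RssProfileExists := by
  intro hbox hred
  classical
  obtain ⟨N, δ, ρ, K, Λ, a, b, cnd, η, Rw, Rb, cg, Γ₂, hN, hδ, hρ, _hcnd, hη, hRw, hRb, hcg, hbox⟩ := hbox
  obtain ⟨Γ₁, hred⟩ := hred N δ ρ K Λ a b cnd η Rw Rb cg hN hδ hρ hη hRw hRb hcg
  obtain ⟨γ, α, X, w, c, m, n, hfam⟩ := hbox (max Γ₁ Γ₂) (le_max_right _ _)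
  -- the derived objects of the skeleton box at circulation `Γ = max Γ₁ Γ₂`
  set Γ : ℝ := max Γ₁ Γ₂
  set u : (Fin N → ℝ) → (Fin N → ℝ → EuclideanSpace ℝ (Fin 3)) → EuclideanSpace ℝ (Fin 3) →
      EuclideanSpace ℝ (Fin 3) := fun p Z y => ∑ k : Fin N, (Γ * γ p k / (4 * π)) • ∫ σ : ℝ,
        ((‖y - Z k σ‖ ^ 2 + 1) ^ (3 / 2 : ℝ))⁻¹ • cross (deriv (Z k) σ) (y - Z k σ)
  set v : (Fin N → ℝ) → EuclideanSpace ℝ (Fin 3) → EuclideanSpace ℝ (Fin 3) :=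
    fun p y => u p (X p) y + (1 / 2 : ℝ) • y - α p • Literature.Analysis.FluidPDE.cross (EuclideanSpace.single (2 : Fin 3) (1 : ℝ)) y
  set A : (Fin N → ℝ) → Fin N → (EuclideanSpace ℝ (Fin 3) →L[ℝ] EuclideanSpace ℝ (Fin 3)) :=
    fun p j => fderiv ℝ (v p) (X p j (c p j))
  set T : (Fin N → ℝ) → (Fin N → ℝ → EuclideanSpace ℝ (Fin 3)) → Fin N → ℝ →
      EuclideanSpace ℝ (Fin 3) :=
    fun p Z j τ => (u p Z (Z j τ) + (1 / 2 : ℝ) • Z j τ - α p • Literature.Analysis.FluidPDE.cross (EuclideanSpace.single (2 : Fin 3) (1 : ℝ)) (Z j τ)) -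
      (inner ℝ (u p Z (Z j τ) + (1 / 2 : ℝ) • Z j τ - α p • Literature.Analysis.FluidPDE.cross (EuclideanSpace.single (2 : Fin 3) (1 : ℝ)) (Z j τ)) (deriv (Z j) τ) /
        ‖deriv (Z j) τ‖ ^ 2) • deriv (Z j) τ
  set D : (Fin N → ℝ) → Fin N → EuclideanSpace ℝ (Fin 3) → EuclideanSpace ℝ (Fin 3) :=
    fun p j y => (Real.exp (-(inner ℝ (y - X p j (c p j)) (deriv (X p j) (c p j))) ^ 2) *
      ((1 - Real.exp (-(‖y - X p j (c p j)‖ ^ 2 -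
        inner ℝ (y - X p j (c p j)) (deriv (X p j) (c p j)) ^ 2))) /
        (‖y - X p j (c p j)‖ ^ 2 - inner ℝ (y - X p j (c p j)) (deriv (X p j) (c p j)) ^ 2))) •
      cross (deriv (X p j) (c p j)) (y - X p j (c p j))
  obtain ⟨⟨hcont, hskel⟩, hsign⟩ := hfam u v A T D (fun _ _ _ => rfl) (fun _ _ => rfl)
    (fun _ _ => rfl) (fun _ _ _ _ => rfl) (fun _ _ _ => rfl)
  obtain ⟨C₀, M, U, P, B, hUPB⟩ := hred Γ (le_max_left _ _) γ α X w c m n u v A T D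
    (fun _ _ _ => rfl) (fun _ _ => rfl) (fun _ _ => rfl) (fun _ _ _ _ => rfl) (fun _ _ _ => rfl)
    ⟨hcont, hskel⟩
  have hs := hsign C₀ M U P B hUPB
  obtain ⟨hBcont, hfamU⟩ := hUPB
  -- the corner `(1,…,1)` and the face points `(1,…,0,…,1)`
  set one : Fin N → ℝ := fun _ => 1
  have hone_mem : ∀ i, one i ∈ Icc (0:ℝ) 1 := fun _ => ⟨zero_le_one, le_rfl⟩
  have hupd_mem : ∀ j i, Function.update one j 0 i ∈ Icc (0:ℝ) 1 := by
    intro j i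
    rcases eq_or_ne i j with rfl | h
    · simp
    · rw [Function.update_of_ne h]; exact hone_mem i
  -- `B one j ≠ 0`, and the signs on the two faces
  have hface0 : ∀ j (p : Fin N → ℝ), (∀ i, p i ∈ Icc (0:ℝ) 1) → p j = 0 → B p j * B one j < 0 :=
    fun j p hp hpj => hs j p one hp hone_mem hpj rfl
  have hone_ne : ∀ j, B one j ≠ 0 := by
    intro j h0
    have := hface0 j (Function.update one j 0) (hupd_mem j) (by simp)
    rw [h0, mul_zero] at this
    exact lt_irrefl _ this
  have hface1 : ∀ j (q : Fin N → ℝ), (∀ i, q i ∈ Icc (0:ℝ) 1) → q j = 1 → 0 < B one j * B q j := by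
    intro j q hq hqj
    have h1 : B (Function.update one j 0) j * B q j < 0 :=
      hs j (Function.update one j 0) q (hupd_mem j) hq (by simp) hqj
    have h2 : B (Function.update one j 0) j * B one j < 0 :=
      hface0 j (Function.update one j 0) (hupd_mem j) (by simp)
    rcases mul_neg_iff.1 h1 with ⟨ha, hb⟩ | ⟨ha, hb⟩
    · rcases mul_neg_iff.1 h2 with ⟨_, hb'⟩ | ⟨ha', _⟩
      · exact mul_pos_of_neg_of_neg hb' hb
      · exact absurd ha (not_lt.2 ha'.le)
    · rcases mul_neg_iff.1 h2 with ⟨ha', _⟩ | ⟨_, hb'⟩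
      · exact absurd ha (not_lt.2 ha'.le)
      · exact mul_pos hb' hb
  -- the sign-normalised accretion map and Poincaré–Miranda
  set f : (Fin N → ℝ) → Fin N → ℝ := fun p j => B one j * B p j
  have hfcont : ContinuousOn f {p : Fin N → ℝ | ∀ i, p i ∈ Icc (0:ℝ) 1} :=
    continuousOn_pi.2 fun j => continuousOn_const.mul ((continuousOn_pi.1 hBcont) j)
  obtain ⟨ps, hps, hzero⟩ := stub_poincareMiranda N f hfcont
    (fun p hp j hpj => by
      have := hface0 j p hp hpj
      show B one j * B p j ≤ 0
      rw [mul_comm]; exact this.le)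
    (fun q hq j hqj => (hface1 j q hq hqj).le)
  have hB0 : ∀ j, B ps j = 0 := fun j =>
    (mul_eq_zero.1 (hzero j)).resolve_left (hone_ne j)
  -- the selected member of the reduced family is an exact profile
  obtain ⟨hU0, hUs, hPs, hdiv, heq, hdec, hPM, -⟩ := hfamU ps hps
  have heq0 : ∀ y : EuclideanSpace ℝ (Fin 3), α ps • (rotGen (U ps y) - fderiv ℝ (U ps) y (rotGen y)) +
      (1 / 2 : ℝ) • U ps y + (1 / 2 : ℝ) • fderiv ℝ (U ps) y y - (Δ (U ps)) y +
      fderiv ℝ (U ps) y (U ps y) + gradient (P ps) y = 0 := by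
    intro y
    simp only [splitGlue_rotGen_eq_cross_single_two]
    rw [heq y]
    simp [hB0]
  exact stub_rssProfileExists_of_profile
    ⟨α ps, C₀, M, U ps, P ps, (hskel ps hps).1, hU0, hUs, hPs, hdiv, heq0, hdec, hPM⟩

/-- **Split glue of the crux `CoreGluing`** = registered tools stub `stub_coreGluingSplit` of
stmt-NavierStokesRegularity-15401 (`ledger workitem stub-add … --name stub_coreGluingSplit`):
`SelectionBox → TransverseReduction → CoreGluing` with both children's statements inlined (= SPLIT-s1 children.json);
the hypothesis `SkeletonEquilibrium` of the crux is not consumed.  Type = `C₁ → C₂ → C` for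
`ledger route edit … --split CoreGluing --into children.json --glue-by`. [folklore] -/
theorem stub_coreGluingSplit :
    (∃ (N : ℕ) (δ ρ K Λ a b cnd η Rw Rb cg Γ₂ : ℝ), 0 < N ∧ 0 < δ ∧ 0 < ρ ∧ 0 < cnd ∧ 0 < η ∧ 0 < Rw ∧ 0
    < Rb ∧ 0 < cg ∧ ∀ Γ : ℝ, Γ₂ ≤ Γ → ∃ (γ : (Fin N → ℝ) → Fin N → ℝ) (α : (Fin N → ℝ) → ℝ) (X : (Fin N
    → ℝ) → Fin N → ℝ → EuclideanSpace ℝ (Fin 3)) (w : (Fin N → ℝ) → Fin N → ℝ → ℝ) (c : (Fin N → ℝ) →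
    Fin N → ℝ) (m n : (Fin N → ℝ) → Fin N → EuclideanSpace ℝ (Fin 3)), ∀ (u : (Fin N → ℝ) → (Fin N → ℝ →
    EuclideanSpace ℝ (Fin 3)) → EuclideanSpace ℝ (Fin 3) → EuclideanSpace ℝ (Fin 3)) (v : (Fin N → ℝ) →
    EuclideanSpace ℝ (Fin 3) → EuclideanSpace ℝ (Fin 3)) (A : (Fin N → ℝ) → Fin N → (EuclideanSpace ℝ
    (Fin 3) →L[ℝ] EuclideanSpace ℝ (Fin 3))) (T : (Fin N → ℝ) → (Fin N → ℝ → EuclideanSpace ℝ (Fin 3)) →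
    Fin N → ℝ → EuclideanSpace ℝ (Fin 3)) (D : (Fin N → ℝ) → Fin N → EuclideanSpace ℝ (Fin 3) →
    EuclideanSpace ℝ (Fin 3)), (∀ p Z y, u p Z y = ∑ k : Fin N, (Γ * γ p k / (4 * Real.pi)) • ∫ σ : ℝ,
    ((‖y - Z k σ‖ ^ 2 + 1) ^ (3 / 2 : ℝ))⁻¹ • Literature.Analysis.FluidPDE.cross (deriv (Z k) σ) (y - Z
    k σ)) → (∀ p y, v p y = u p (X p) y + (1 / 2 : ℝ) • y - α p • Literature.Analysis.FluidPDE.cross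
    (EuclideanSpace.single (2 : Fin 3) (1 : ℝ)) y) → (∀ p j, A p j = fderiv ℝ (v p) (X p j (c p j))) →
    (∀ p Z j τ, T p Z j τ = (u p Z (Z j τ) + (1 / 2 : ℝ) • Z j τ - α p •
    Literature.Analysis.FluidPDE.cross (EuclideanSpace.single (2 : Fin 3) (1 : ℝ)) (Z j τ)) - (inner ℝ
    (u p Z (Z j τ) + (1 / 2 : ℝ) • Z j τ - α p • Literature.Analysis.FluidPDE.cross
    (EuclideanSpace.single (2 : Fin 3) (1 : ℝ)) (Z j τ)) (deriv (Z j) τ) / ‖deriv (Z j) τ‖ ^ 2) • deriv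
    (Z j) τ) → (∀ p j y, D p j y = (Real.exp (-(inner ℝ (y - X p j (c p j)) (deriv (X p j) (c p j))) ^
    2) * ((1 - Real.exp (-(‖y - X p j (c p j)‖ ^ 2 - inner ℝ (y - X p j (c p j)) (deriv (X p j) (c p j))
    ^ 2))) / (‖y - X p j (c p j)‖ ^ 2 - inner ℝ (y - X p j (c p j)) (deriv (X p j) (c p j)) ^ 2))) •
    Literature.Analysis.FluidPDE.cross (deriv (X p j) (c p j)) (y - X p j (c p j))) → ((∀ j,
    ContinuousOn (fun q : (Fin N → ℝ) × ℝ => (α q.1, γ q.1 j, X q.1 j q.2, w q.1 j q.2)) ({p : Fin N → ℝ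
    | ∀ i, p i ∈ Set.Icc (0:ℝ) 1} ×ˢ Set.univ)) ∧ (∀ p : Fin N → ℝ, (∀ i, p i ∈ Set.Icc (0:ℝ) 1) → α p ≠
    0 ∧ (∀ j, γ p j ≠ 0) ∧ (∀ j, ContDiff ℝ 2 (X p j) ∧ Differentiable ℝ (w p j) ∧ (∀ τ, ‖deriv (X p j)
    τ‖ = 1) ∧ (∀ τ, ‖iteratedDeriv 2 (X p j) τ‖ * Real.sqrt Γ ≤ K) ∧ Filter.Tendsto (fun τ => ‖X p j τ‖)
    (Filter.cocompact ℝ) Filter.atTop) ∧ (∀ j k, j ≠ k → ∀ τ σ, ρ * Real.sqrt Γ ≤ ‖X p j τ - X p k σ‖) ∧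
    (∀ j τ σ, ρ * Real.sqrt Γ ≤ |τ - σ| → cg * ρ * Real.sqrt Γ ≤ ‖X p j τ - X p j σ‖) ∧ (∀ j τ, cg * |τ
    - c p j| ≤ Rw * Real.sqrt Γ + ‖X p j τ‖) ∧ (∀ j τ, w p j τ = inner ℝ (v p (X p j τ)) (deriv (X p j)
    τ)) ∧ (∀ j τ, ‖X p j τ‖ ≤ Rb * Real.sqrt (Γ * Real.log Γ) → v p (X p j τ) = w p j τ • deriv (X p j)
    τ) ∧ (∀ j, ‖X p j (c p j)‖ ≤ Rw * Real.sqrt Γ) ∧ (∀ j, w p j (c p j) = 0 ∧ (∀ τ, w p j τ = 0 → τ = c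
    p j) ∧ 3 / 2 + δ ≤ deriv (w p j) (c p j) ∧ deriv (w p j) (c p j) ≤ Λ) ∧ (∀ j, Orthonormal ℝ ![deriv
    (X p j) (c p j), m p j, n p j] ∧ inner ℝ (A p j (m p j)) (m p j) + inner ℝ (A p j (n p j)) (n p j) <
    0 ∧ inner ℝ (A p j (n p j)) (m p j) * inner ℝ (A p j (m p j)) (n p j) < inner ℝ (A p j (m p j)) (m p
    j) * inner ℝ (A p j (n p j)) (n p j)) ∧ (∀ Y : Fin N → ℝ → EuclideanSpace ℝ (Fin 3), (∀ j, ContDiff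
    ℝ 2 (Y j)) → (∀ j τ, inner ℝ (Y j τ) (deriv (X p j) τ) = 0) → ∑ j : Fin N, inner ℝ (Y j (c p j))
    (Literature.Analysis.FluidPDE.cross (EuclideanSpace.single (2 : Fin 3) (1 : ℝ)) (X p j (c p j))) = 0
    → (∀ j τ, ‖Y j τ‖ + ‖deriv (Y j) τ‖ + ‖iteratedDeriv 2 (Y j) τ‖ ≤ (1 + |τ - c p j|) ^ b) → ∀ L : ℝ,
    (∀ j τ, ‖deriv (fun s : ℝ => T p (fun k σ => X p k σ + s • Y k σ) j τ) 0‖ ≤ L * (1 + |τ - c p j|) ^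
    a) → ∀ j τ, ‖Y j τ‖ ≤ cnd * L * (1 + |τ - c p j|) ^ b))) ∧ (∀ (C₀ M : ℝ) (U : (Fin N → ℝ) →
    EuclideanSpace ℝ (Fin 3) → EuclideanSpace ℝ (Fin 3)) (P : (Fin N → ℝ) → EuclideanSpace ℝ (Fin 3) →
    ℝ) (B : (Fin N → ℝ) → Fin N → ℝ), (ContinuousOn B {p : Fin N → ℝ | ∀ i, p i ∈ Set.Icc (0:ℝ) 1} ∧ ∀ p
    : Fin N → ℝ, (∀ i, p i ∈ Set.Icc (0:ℝ) 1) → U p ≠ 0 ∧ ContDiff ℝ (⊤ : ℕ∞) (U p) ∧ ContDiff ℝ (⊤ :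
    ℕ∞) (P p) ∧ Literature.Analysis.FluidPDE.VectorCalculus.IsDivFree (U p) ∧ (∀ y, α p •
    (Literature.Analysis.FluidPDE.cross (EuclideanSpace.single (2 : Fin 3) (1 : ℝ)) (U p y) - fderiv ℝ
    (U p) y (Literature.Analysis.FluidPDE.cross (EuclideanSpace.single (2 : Fin 3) (1 : ℝ)) y)) + (1 / 2
    : ℝ) • U p y + (1 / 2 : ℝ) • fderiv ℝ (U p) y y - (Laplacian.laplacian (U p)) y + fderiv ℝ (U p) y
    (U p y) + gradient (P p) y = ∑ j : Fin N, B p j • D p j y) ∧ (∀ y, ‖U p y‖ ≤ C₀ / (1 + ‖y‖)) ∧ (∀ y,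
    |P p y| ≤ M) ∧ (∀ y, ‖y‖ ≤ Rw * Real.sqrt Γ → (∀ j τ, ρ * Real.sqrt Γ / 4 ≤ ‖y - X p j τ‖) → ‖U p y
    - u p (X p) y‖ ≤ η * Real.sqrt Γ)) → (∀ (j : Fin N) (p q : Fin N → ℝ), (∀ i, p i ∈ Set.Icc (0:ℝ) 1)
    → (∀ i, q i ∈ Set.Icc (0:ℝ) 1) → p j = 0 → q j = 1 → B p j * B q j < 0))) →
    (∀ (N : ℕ) (δ ρ K Λ a b cnd η Rw Rb cg : ℝ), 0 < N → 0 < δ → 0 < ρ → 0 < η → 0 < Rw → 0 < Rb → 0 < cg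
    → ∃ Γ₁ : ℝ, ∀ Γ : ℝ, Γ₁ ≤ Γ → ∀ (γ : (Fin N → ℝ) → Fin N → ℝ) (α : (Fin N → ℝ) → ℝ) (X : (Fin N → ℝ)
    → Fin N → ℝ → EuclideanSpace ℝ (Fin 3)) (w : (Fin N → ℝ) → Fin N → ℝ → ℝ) (c : (Fin N → ℝ) → Fin N →
    ℝ) (m n : (Fin N → ℝ) → Fin N → EuclideanSpace ℝ (Fin 3)) (u : (Fin N → ℝ) → (Fin N → ℝ →
    EuclideanSpace ℝ (Fin 3)) → EuclideanSpace ℝ (Fin 3) → EuclideanSpace ℝ (Fin 3)) (v : (Fin N → ℝ) →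
    EuclideanSpace ℝ (Fin 3) → EuclideanSpace ℝ (Fin 3)) (A : (Fin N → ℝ) → Fin N → (EuclideanSpace ℝ
    (Fin 3) →L[ℝ] EuclideanSpace ℝ (Fin 3))) (T : (Fin N → ℝ) → (Fin N → ℝ → EuclideanSpace ℝ (Fin 3)) →
    Fin N → ℝ → EuclideanSpace ℝ (Fin 3)) (D : (Fin N → ℝ) → Fin N → EuclideanSpace ℝ (Fin 3) →
    EuclideanSpace ℝ (Fin 3)), (∀ p Z y, u p Z y = ∑ k : Fin N, (Γ * γ p k / (4 * Real.pi)) • ∫ σ : ℝ,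
    ((‖y - Z k σ‖ ^ 2 + 1) ^ (3 / 2 : ℝ))⁻¹ • Literature.Analysis.FluidPDE.cross (deriv (Z k) σ) (y - Z
    k σ)) → (∀ p y, v p y = u p (X p) y + (1 / 2 : ℝ) • y - α p • Literature.Analysis.FluidPDE.cross
    (EuclideanSpace.single (2 : Fin 3) (1 : ℝ)) y) → (∀ p j, A p j = fderiv ℝ (v p) (X p j (c p j))) →
    (∀ p Z j τ, T p Z j τ = (u p Z (Z j τ) + (1 / 2 : ℝ) • Z j τ - α p •
    Literature.Analysis.FluidPDE.cross (EuclideanSpace.single (2 : Fin 3) (1 : ℝ)) (Z j τ)) - (inner ℝ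
    (u p Z (Z j τ) + (1 / 2 : ℝ) • Z j τ - α p • Literature.Analysis.FluidPDE.cross
    (EuclideanSpace.single (2 : Fin 3) (1 : ℝ)) (Z j τ)) (deriv (Z j) τ) / ‖deriv (Z j) τ‖ ^ 2) • deriv
    (Z j) τ) → (∀ p j y, D p j y = (Real.exp (-(inner ℝ (y - X p j (c p j)) (deriv (X p j) (c p j))) ^
    2) * ((1 - Real.exp (-(‖y - X p j (c p j)‖ ^ 2 - inner ℝ (y - X p j (c p j)) (deriv (X p j) (c p j))
    ^ 2))) / (‖y - X p j (c p j)‖ ^ 2 - inner ℝ (y - X p j (c p j)) (deriv (X p j) (c p j)) ^ 2))) •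
    Literature.Analysis.FluidPDE.cross (deriv (X p j) (c p j)) (y - X p j (c p j))) → ((∀ j,
    ContinuousOn (fun q : (Fin N → ℝ) × ℝ => (α q.1, γ q.1 j, X q.1 j q.2, w q.1 j q.2)) ({p : Fin N → ℝ
    | ∀ i, p i ∈ Set.Icc (0:ℝ) 1} ×ˢ Set.univ)) ∧ (∀ p : Fin N → ℝ, (∀ i, p i ∈ Set.Icc (0:ℝ) 1) → α p ≠
    0 ∧ (∀ j, γ p j ≠ 0) ∧ (∀ j, ContDiff ℝ 2 (X p j) ∧ Differentiable ℝ (w p j) ∧ (∀ τ, ‖deriv (X p j)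
    τ‖ = 1) ∧ (∀ τ, ‖iteratedDeriv 2 (X p j) τ‖ * Real.sqrt Γ ≤ K) ∧ Filter.Tendsto (fun τ => ‖X p j τ‖)
    (Filter.cocompact ℝ) Filter.atTop) ∧ (∀ j k, j ≠ k → ∀ τ σ, ρ * Real.sqrt Γ ≤ ‖X p j τ - X p k σ‖) ∧
    (∀ j τ σ, ρ * Real.sqrt Γ ≤ |τ - σ| → cg * ρ * Real.sqrt Γ ≤ ‖X p j τ - X p j σ‖) ∧ (∀ j τ, cg * |τ
    - c p j| ≤ Rw * Real.sqrt Γ + ‖X p j τ‖) ∧ (∀ j τ, w p j τ = inner ℝ (v p (X p j τ)) (deriv (X p j)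
    τ)) ∧ (∀ j τ, ‖X p j τ‖ ≤ Rb * Real.sqrt (Γ * Real.log Γ) → v p (X p j τ) = w p j τ • deriv (X p j)
    τ) ∧ (∀ j, ‖X p j (c p j)‖ ≤ Rw * Real.sqrt Γ) ∧ (∀ j, w p j (c p j) = 0 ∧ (∀ τ, w p j τ = 0 → τ = c
    p j) ∧ 3 / 2 + δ ≤ deriv (w p j) (c p j) ∧ deriv (w p j) (c p j) ≤ Λ) ∧ (∀ j, Orthonormal ℝ ![deriv
    (X p j) (c p j), m p j, n p j] ∧ inner ℝ (A p j (m p j)) (m p j) + inner ℝ (A p j (n p j)) (n p j) <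
    0 ∧ inner ℝ (A p j (n p j)) (m p j) * inner ℝ (A p j (m p j)) (n p j) < inner ℝ (A p j (m p j)) (m p
    j) * inner ℝ (A p j (n p j)) (n p j)) ∧ (∀ Y : Fin N → ℝ → EuclideanSpace ℝ (Fin 3), (∀ j, ContDiff
    ℝ 2 (Y j)) → (∀ j τ, inner ℝ (Y j τ) (deriv (X p j) τ) = 0) → ∑ j : Fin N, inner ℝ (Y j (c p j))
    (Literature.Analysis.FluidPDE.cross (EuclideanSpace.single (2 : Fin 3) (1 : ℝ)) (X p j (c p j))) = 0
    → (∀ j τ, ‖Y j τ‖ + ‖deriv (Y j) τ‖ + ‖iteratedDeriv 2 (Y j) τ‖ ≤ (1 + |τ - c p j|) ^ b) → ∀ L : ℝ,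
    (∀ j τ, ‖deriv (fun s : ℝ => T p (fun k σ => X p k σ + s • Y k σ) j τ) 0‖ ≤ L * (1 + |τ - c p j|) ^
    a) → ∀ j τ, ‖Y j τ‖ ≤ cnd * L * (1 + |τ - c p j|) ^ b))) → ∃ (C₀ M : ℝ) (U : (Fin N → ℝ) →
    EuclideanSpace ℝ (Fin 3) → EuclideanSpace ℝ (Fin 3)) (P : (Fin N → ℝ) → EuclideanSpace ℝ (Fin 3) →
    ℝ) (B : (Fin N → ℝ) → Fin N → ℝ), (ContinuousOn B {p : Fin N → ℝ | ∀ i, p i ∈ Set.Icc (0:ℝ) 1} ∧ ∀ p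
    : Fin N → ℝ, (∀ i, p i ∈ Set.Icc (0:ℝ) 1) → U p ≠ 0 ∧ ContDiff ℝ (⊤ : ℕ∞) (U p) ∧ ContDiff ℝ (⊤ :
    ℕ∞) (P p) ∧ Literature.Analysis.FluidPDE.VectorCalculus.IsDivFree (U p) ∧ (∀ y, α p •
    (Literature.Analysis.FluidPDE.cross (EuclideanSpace.single (2 : Fin 3) (1 : ℝ)) (U p y) - fderiv ℝ
    (U p) y (Literature.Analysis.FluidPDE.cross (EuclideanSpace.single (2 : Fin 3) (1 : ℝ)) y)) + (1 / 2
    : ℝ) • U p y + (1 / 2 : ℝ) • fderiv ℝ (U p) y y - (Laplacian.laplacian (U p)) y + fderiv ℝ (U p) y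
    (U p y) + gradient (P p) y = ∑ j : Fin N, B p j • D p j y) ∧ (∀ y, ‖U p y‖ ≤ C₀ / (1 + ‖y‖)) ∧ (∀ y,
    |P p y| ≤ M) ∧ (∀ y, ‖y‖ ≤ Rw * Real.sqrt Γ → (∀ j τ, ρ * Real.sqrt Γ / 4 ≤ ‖y - X p j τ‖) → ‖U p y
    - u p (X p) y‖ ≤ η * Real.sqrt Γ))) →
    Summit.NavierStokesRegularity.NavierStokesRegularity.Theses.FilamentSkeletonRss.CoreGluing :=
  fun hbox hred _ => rssProfileExists_of_selectionBox_transverseReduction hbox hred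


end Summit.NavierStokesRegularity.NavierStokesRegularity.Theorems

end
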